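import Mathlib
import Literature.NumberTheory.LFunctions.Zhang2022.Section2SmoothWeight
import Literature.NumberTheory.LFunctions.Zhang2022.Section5DeltaAnalytic
import Literature.NumberTheory.LFunctions.Zhang2022.Section5Lemma53CaseOne
import HarnessLib

/-!
# Zhang (2022), §5, Lemma 5.4 (ii): "If `|s−1| < 10α`, then `δ(s) = 1 + O(α log 𝓛)`" — the
# proof's decomposition of `δ(s) − 1`, EXACT, and the resulting structural bound, kernel-checked

Topic `Literature/NumberTheory/LFunctions/Zhang2022` (Landau–Siegel autopsy tree; verdict-neutral).
Y. Zhang, *Discrete mean estimates and the Landau–Siegel zero*, arXiv:2211.02515v1 (2022) — **an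
unrefereed manuscript, a claimed result under adjudication** (cell pub-zhang: audit + repair census
of arXiv:2211.02515; no claim about Landau–Siegel).

Glossary: `\l` = `𝓛 = log D`; `𝓛₁ = 𝓛^{405}`, `𝓛₂ = 𝓛^{400}`, `t₀ = 𝓛^{519}` ((2.8), (2.15));
`ω(1/2 + 2πix) = (√π/𝓛₂)exp{−(π(x−t₀)/𝓛₂)²}` (`SmoothWeight.omegaLine`); `Δ` is (5.10)
(`Lemma53.Delta510`); `δ(s) = ∫₀^∞ Δ(x)x^{s−1} dx` is (5.14) (`Lemma53.delta514`). Source, §5 p. 11: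

> (ii). Assume `|s−1| < 10α`. By Lemma 5.3, on the right side of (5.14), the integral on the part
> `|x−t₀| ≥ 𝓛₁` contributes `O(ε)`. For `|x−t₀| < 𝓛₁` we have `x^{s−1} = 1 + O(α log 𝓛)`.
> Since `∫₀^∞ ω(1/2+2πix) dx = 1 + O(ε)`, (ii) follows.

This file PROVES, for free reals `L₂ ≥ 1`, `0 < ℓ < t₀` (window `W = (t₀−ℓ, t₀+ℓ) ⊂ (0,∞)`; the
source: `ℓ = 𝓛₁`) and every `s` with `σ > 0`:

* `SmoothWeight.integral_omegaLine_Iic_sub_le` / `integral_omegaLine_Ici_add_le` — the Gaussian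
  window tails `∫_{x ≤ t₀−ℓ} ω, ∫_{x ≥ t₀+ℓ} ω ≤ ½e^{−(πℓ/𝓛₂)²}`;
  `SmoothWeight.abs_integral_omegaLine_window_sub_one_le` — "`∫ ω(1/2+2πix) dx = 1 + O(ε)`" on the
  window: `|∫_W ω − 1| ≤ e^{−(πℓ/𝓛₂)²}`;
* `Lemma53.delta514_sub_one_eq` — the proof's decomposition, EXACT:
  `δ(s) − 1 = ∫_{(0,∞)∖W} Δx^{s−1} + ∫_W Δ·(x^{s−1} − 1) + ∫_W (Δ − ω) + (∫_W ω − 1)`;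
* `Lemma53.norm_delta514_sub_one_le` — **Lemma 5.4 (ii), structural form**: if `|log x| ≤ Λ` on
  `W` and `‖s − 1‖·Λ ≤ 1`, then
  `‖δ(s) − 1‖ ≤ ∫_{(0,∞)∖W} ‖Δ‖x^{σ−1} + 2‖s−1‖Λ·∫_W ‖Δ‖ + ∫_W ‖Δ − ω‖ + e^{−(πℓ/𝓛₂)²}`
  (the four inputs of the printed proof: the far part "contributes `O(ε)`" [Lemma 5.3], the window
  factor "`x^{s−1} = 1 + O(α log 𝓛)`" [`norm_cpow_sub_one_le`], the window comparison `Δ ≈ ω`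
  [(5.8), `norm_Delta510_sub_omega_le`], and "`∫ω = 1 + O(ε)`").

* `Lemma53.integral_window_norm_Delta510_sub_omegaLine_le` — the window comparison term made
  EXPLICIT by (5.8) (`norm_Delta510_sub_omega_le`, `tail_le`): for `U ≥ 0`,
  `√(U² + (πℓ/𝓛₂²)²) ≤ ρ ≤ 1`, `4π(t₀+ℓ)ρ² ≤ 1`,
  `∫_W ‖Δ − ω‖ ≤ 2ℓ·(1 + e^{1/(8𝓛₂²)})(√(2π)/𝓛₂)e^{−𝓛₂²U²/2} + (ρ + 4π(t₀+ℓ)ρ²)(1 + (4πℓ²/𝓛₂²)e^{−𝓛₂²U²})`;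
  `Lemma53.norm_delta514_sub_one_le_explicit` — (ii) with the second and third terms so bounded
  (`∫_W ‖Δ‖ ≤ ∫_W ‖Δ − ω‖ + 1`), leaving only the far part `∫_{(0,∞)∖W} ‖Δ‖x^{σ−1}` as an integral.

What is NOT asserted: the SIZES of the first three terms under the manuscript's parameter values
(`O(ε)`, `O(α log 𝓛)`), i.e. the implied constants of "`δ(s) = 1 + O(α log 𝓛)`". Nothing about
Theorems 1–2 of the source is stated or implied; nothing here bears on the cell's verdict on (8.24).

## References

* Y. Zhang, arXiv:2211.02515v1 (2022), §5 p. 11, Lemma 5.4 (ii) and its proof; (2.8), (2.15),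
  (5.8), (5.14). [cite: Zhang2022LandauSiegel, §5 Lemma 5.4 (ii)]
-/

noncomputable section

open Complex Real Set MeasureTheory Filter Topology

namespace Literature.NumberTheory.LFunctions.Zhang2022

/-! ## Window tails of `ω(1/2 + 2πix)` -/

namespace SmoothWeight

/-- Translating the variable shifts the centre: `ω_{t₀}(x + a) = ω_{t₀−a}(x)`.
[cite: Zhang2022LandauSiegel, §2 (2.15)] -/
theorem omegaLine_add_right (L₂ t₀ a x : ℝ) :
    omegaLine L₂ t₀ (x + a) = omegaLine L₂ (t₀ - a) x := by
  rw [omegaLine_def, omegaLine_def, show x + a - t₀ = x - (t₀ - a) by ring]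

/-- Reflecting the variable reflects the centre: `ω_{t₀}(−x) = ω_{−t₀}(x)`.
[cite: Zhang2022LandauSiegel, §2 (2.15)] -/
theorem omegaLine_neg (L₂ t₀ x : ℝ) : omegaLine L₂ t₀ (-x) = omegaLine L₂ (-t₀) x := by
  rw [omegaLine_def, omegaLine_def, show -x - t₀ = -(x - -t₀) by ring, mul_neg, neg_div, neg_sq]

/-- Translation of a left half-line integral. [folklore] -/
private lemma setIntegral_Iic_comp_add_right (f : ℝ → ℝ) (a c : ℝ) :
    ∫ x in Iic c, f (x + a) = ∫ y in Iic (c + a), f y := by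
  have A : MeasurableEmbedding fun x : ℝ => x + a :=
    (Homeomorph.addRight a).isClosedEmbedding.measurableEmbedding
  have h := A.setIntegral_map (μ := volume) f (Iic (c + a))
  rw [map_add_right_eq_self] at h
  have e : (fun x : ℝ => x + a) ⁻¹' Iic (c + a) = Iic c := by
    ext x; simp
  rw [h, e]

/-- **Left window tail**: `∫_{x ≤ t₀−ℓ} ω(1/2+2πix) dx ≤ ½e^{−(πℓ/𝓛₂)²}` (`ℓ ≥ 0`).
[cite: Zhang2022LandauSiegel, §5 Lemma 5.4 (ii) (proof)] -/
theorem integral_omegaLine_Iic_sub_le {L₂ : ℝ} (hL : 0 < L₂) (t₀ : ℝ) {ℓ : ℝ} (hℓ : 0 ≤ ℓ) :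
    ∫ x in Iic (t₀ - ℓ), omegaLine L₂ t₀ x ≤ 1 / 2 * Real.exp (-(π * ℓ / L₂) ^ 2) := by
  have h := setIntegral_Iic_comp_add_right (omegaLine L₂ t₀) (t₀ - ℓ) 0
  rw [zero_add] at h
  rw [← h]
  simp_rw [omegaLine_add_right, sub_sub_cancel]
  exact integral_omegaLine_Iic_le hL hℓ

/-- **Right window tail**: `∫_{x ≥ t₀+ℓ} ω(1/2+2πix) dx ≤ ½e^{−(πℓ/𝓛₂)²}` (`ℓ ≥ 0`).
[cite: Zhang2022LandauSiegel, §5 Lemma 5.4 (ii) (proof)] -/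
theorem integral_omegaLine_Ici_add_le {L₂ : ℝ} (hL : 0 < L₂) (t₀ : ℝ) {ℓ : ℝ} (hℓ : 0 ≤ ℓ) :
    ∫ x in Ici (t₀ + ℓ), omegaLine L₂ t₀ x ≤ 1 / 2 * Real.exp (-(π * ℓ / L₂) ^ 2) := by
  rw [integral_Ici_eq_integral_Ioi]
  have h := integral_comp_neg_Iic (-(t₀ + ℓ)) (omegaLine L₂ t₀)
  rw [neg_neg] at h
  rw [← h]
  simp_rw [omegaLine_neg]
  rw [show -(t₀ + ℓ) = -t₀ - ℓ by ring]
  exact integral_omegaLine_Iic_sub_le hL (-t₀) hℓ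

/-- **"`∫₀^∞ ω(1/2+2πix) dx = 1 + O(ε)`", window form**: for `ℓ > 0`,
`1 − e^{−(πℓ/𝓛₂)²} ≤ ∫_{t₀−ℓ}^{t₀+ℓ} ω(1/2+2πix) dx ≤ 1`.
[cite: Zhang2022LandauSiegel, §5 Lemma 5.4 (ii) (proof)] -/
theorem integral_omegaLine_window {L₂ : ℝ} (hL : 0 < L₂) (t₀ : ℝ) {ℓ : ℝ} (hℓ : 0 < ℓ) :
    1 - Real.exp (-(π * ℓ / L₂) ^ 2) ≤ ∫ x in Ioo (t₀ - ℓ) (t₀ + ℓ), omegaLine L₂ t₀ x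
      ∧ ∫ x in Ioo (t₀ - ℓ) (t₀ + ℓ), omegaLine L₂ t₀ x ≤ 1 := by
  have hint := integrable_omegaLine hL t₀
  have h := integral_add_compl (measurableSet_Ioo (a := t₀ - ℓ) (b := t₀ + ℓ)) hint
  rw [integral_omegaLine hL] at h
  have hc : (Ioo (t₀ - ℓ) (t₀ + ℓ))ᶜ = Iic (t₀ - ℓ) ∪ Ici (t₀ + ℓ) := by
    ext x
    simp only [mem_compl_iff, mem_Ioo, mem_union, mem_Iic, mem_Ici, not_and_or, not_lt]
  have hdisj : Disjoint (Iic (t₀ - ℓ)) (Ici (t₀ + ℓ)) := by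
    rw [Set.disjoint_iff]
    intro x hx
    have h1 : x ≤ t₀ - ℓ := hx.1
    have h2 : t₀ + ℓ ≤ x := hx.2
    linarith
  have htail : ∫ x in (Ioo (t₀ - ℓ) (t₀ + ℓ))ᶜ, omegaLine L₂ t₀ x ≤ Real.exp (-(π * ℓ / L₂) ^ 2) := by
    rw [hc, setIntegral_union hdisj measurableSet_Ici hint.integrableOn hint.integrableOn]
    have h1 := integral_omegaLine_Iic_sub_le hL t₀ hℓ.le
    have h2 := integral_omegaLine_Ici_add_le hL t₀ hℓ.le
    linarith
  have htail0 : 0 ≤ ∫ x in (Ioo (t₀ - ℓ) (t₀ + ℓ))ᶜ, omegaLine L₂ t₀ x :=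
    setIntegral_nonneg measurableSet_Ioo.compl fun x _ => omegaLine_nonneg hL t₀ x
  constructor <;> linarith

/-- `|∫_{t₀−ℓ}^{t₀+ℓ} ω(1/2+2πix) dx − 1| ≤ e^{−(πℓ/𝓛₂)²}` (`ℓ > 0`).
[cite: Zhang2022LandauSiegel, §5 Lemma 5.4 (ii) (proof)] -/
theorem abs_integral_omegaLine_window_sub_one_le {L₂ : ℝ} (hL : 0 < L₂) (t₀ : ℝ) {ℓ : ℝ}
    (hℓ : 0 < ℓ) :
    |(∫ x in Ioo (t₀ - ℓ) (t₀ + ℓ), omegaLine L₂ t₀ x) - 1| ≤ Real.exp (-(π * ℓ / L₂) ^ 2) := by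
  obtain ⟨h1, h2⟩ := integral_omegaLine_window hL t₀ hℓ
  rw [abs_le]
  constructor <;> linarith

end SmoothWeight

/-! ## The decomposition of `δ(s) − 1` in the proof of Lemma 5.4 (ii) -/

namespace Lemma53

open SmoothWeight

/-- `Δ` is integrable on the window. [folklore] -/
private lemma integrableOn_Delta510_window {L₂ : ℝ} (hL : L₂ ≠ 0) (t₀ a b : ℝ) :
    IntegrableOn (Delta510 L₂ t₀) (Ioo a b) :=
  ((continuous_Delta510 hL t₀).integrableOn_Icc (a := a) (b := b)).mono_set Ioo_subset_Icc_self

/-- **The proof's decomposition of `δ(s) − 1`, EXACT**: for `L₂ ≥ 1`, `ℓ < t₀`, `σ > 0`, with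
`W = (t₀−ℓ, t₀+ℓ) ⊂ (0, ∞)`:
`δ(s) − 1 = ∫_{(0,∞)∖W} Δ(x)x^{s−1} dx + ∫_W Δ(x)(x^{s−1} − 1) dx + ∫_W (Δ(x) − ω(1/2+2πix)) dx
  + (∫_W ω(1/2+2πix) dx − 1)`. [cite: Zhang2022LandauSiegel, §5 Lemma 5.4 (ii) (proof)] -/
theorem delta514_sub_one_eq {L₂ : ℝ} (hL : 1 ≤ L₂) {t₀ ℓ : ℝ} (hℓt : ℓ < t₀)
    {s : ℂ} (hs : 0 < s.re) :
    delta514 L₂ t₀ s - 1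
      = (∫ x in Ioi 0 \ Ioo (t₀ - ℓ) (t₀ + ℓ), Delta510 L₂ t₀ x * (x : ℂ) ^ (s - 1))
        + (∫ x in Ioo (t₀ - ℓ) (t₀ + ℓ), Delta510 L₂ t₀ x * ((x : ℂ) ^ (s - 1) - 1))
        + (∫ x in Ioo (t₀ - ℓ) (t₀ + ℓ), (Delta510 L₂ t₀ x - (omegaLine L₂ t₀ x : ℂ)))
        + ((∫ x in Ioo (t₀ - ℓ) (t₀ + ℓ), (omegaLine L₂ t₀ x : ℂ)) - 1) := by
  have hL0 : 0 < L₂ := by linarith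
  have hW : Ioo (t₀ - ℓ) (t₀ + ℓ) ⊆ Ioi 0 := fun x hx => by
    have : 0 < t₀ - ℓ := by linarith
    exact lt_trans this hx.1
  have hf := integrableOn_Delta510_mul_cpow hL t₀ hs
  have hfW : IntegrableOn (fun x : ℝ => Delta510 L₂ t₀ x * (x : ℂ) ^ (s - 1))
      (Ioo (t₀ - ℓ) (t₀ + ℓ)) := hf.mono_set hW
  have hΔW := integrableOn_Delta510_window hL0.ne' t₀ (t₀ - ℓ) (t₀ + ℓ)
  have hωW : IntegrableOn (fun x : ℝ => (omegaLine L₂ t₀ x : ℂ)) (Ioo (t₀ - ℓ) (t₀ + ℓ)) :=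
    (integrable_omegaLine hL0 t₀).ofReal.integrableOn
  have h2 : IntegrableOn (fun x : ℝ => Delta510 L₂ t₀ x * ((x : ℂ) ^ (s - 1) - 1))
      (Ioo (t₀ - ℓ) (t₀ + ℓ)) :=
    (hfW.sub hΔW).congr (Eventually.of_forall fun x => by simp only [Pi.sub_apply]; ring)
  have h3 : IntegrableOn (fun x : ℝ => Delta510 L₂ t₀ x - (omegaLine L₂ t₀ x : ℂ))
      (Ioo (t₀ - ℓ) (t₀ + ℓ)) := hΔW.sub hωW
  have hsd := setIntegral_sdiff (measurableSet_Ioo (a := t₀ - ℓ) (b := t₀ + ℓ)) hf hW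
  have hsplit : ∫ x in Ioo (t₀ - ℓ) (t₀ + ℓ), Delta510 L₂ t₀ x * (x : ℂ) ^ (s - 1)
      = (∫ x in Ioo (t₀ - ℓ) (t₀ + ℓ), Delta510 L₂ t₀ x * ((x : ℂ) ^ (s - 1) - 1))
        + (∫ x in Ioo (t₀ - ℓ) (t₀ + ℓ), (Delta510 L₂ t₀ x - (omegaLine L₂ t₀ x : ℂ)))
        + (∫ x in Ioo (t₀ - ℓ) (t₀ + ℓ), (omegaLine L₂ t₀ x : ℂ)) := by
    have h23 : IntegrableOn (fun x : ℝ => Delta510 L₂ t₀ x * ((x : ℂ) ^ (s - 1) - 1)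
        + (Delta510 L₂ t₀ x - (omegaLine L₂ t₀ x : ℂ))) (Ioo (t₀ - ℓ) (t₀ + ℓ)) := h2.add h3
    rw [← integral_add h2 h3, ← integral_add h23 hωW]
    congr 1
    funext x
    ring
  rw [delta514, hsd, hsplit]
  ring

/-- **Lemma 5.4 (ii), structural form**: for `L₂ ≥ 1`, `0 < ℓ < t₀`, `σ > 0`, a bound
`|log x| ≤ Λ` on the window `W = (t₀−ℓ, t₀+ℓ)` and `‖s − 1‖·Λ ≤ 1`:
`‖δ(s) − 1‖ ≤ ∫_{(0,∞)∖W} ‖Δ(x)‖x^{σ−1} dx + 2‖s−1‖Λ·∫_W ‖Δ(x)‖ dx + ∫_W ‖Δ(x) − ω(1/2+2πix)‖ dx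
  + e^{−(πℓ/𝓛₂)²}`
— the four inputs of the printed proof (far part [Lemma 5.3]; "`x^{s−1} = 1 + O(α log 𝓛)`";
`Δ = ω(1 + O(α)) + O(ε)` on the window [(5.8)]; "`∫ω = 1 + O(ε)`"), sizes not asserted.
[cite: Zhang2022LandauSiegel, §5 Lemma 5.4 (ii)] -/
theorem norm_delta514_sub_one_le {L₂ : ℝ} (hL : 1 ≤ L₂) {t₀ ℓ : ℝ} (hℓ : 0 < ℓ) (hℓt : ℓ < t₀)
    {s : ℂ} (hs : 0 < s.re) {Λ : ℝ} (hΛ : ∀ x ∈ Ioo (t₀ - ℓ) (t₀ + ℓ), |Real.log x| ≤ Λ)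
    (hsΛ : ‖s - 1‖ * Λ ≤ 1) :
    ‖delta514 L₂ t₀ s - 1‖
      ≤ (∫ x in Ioi 0 \ Ioo (t₀ - ℓ) (t₀ + ℓ), ‖Delta510 L₂ t₀ x‖ * x ^ (s.re - 1))
        + 2 * ‖s - 1‖ * Λ * (∫ x in Ioo (t₀ - ℓ) (t₀ + ℓ), ‖Delta510 L₂ t₀ x‖)
        + (∫ x in Ioo (t₀ - ℓ) (t₀ + ℓ), ‖Delta510 L₂ t₀ x - (omegaLine L₂ t₀ x : ℂ)‖)
        + Real.exp (-(π * ℓ / L₂) ^ 2) := by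
  have hL0 : 0 < L₂ := by linarith
  have hW : Ioo (t₀ - ℓ) (t₀ + ℓ) ⊆ Ioi 0 := fun x hx => by
    have : 0 < t₀ - ℓ := by linarith
    exact lt_trans this hx.1
  have hf := integrableOn_Delta510_mul_cpow hL t₀ hs
  have hfW : IntegrableOn (fun x : ℝ => Delta510 L₂ t₀ x * (x : ℂ) ^ (s - 1))
      (Ioo (t₀ - ℓ) (t₀ + ℓ)) := hf.mono_set hW
  have hΔW := integrableOn_Delta510_window hL0.ne' t₀ (t₀ - ℓ) (t₀ + ℓ)
  have h2 : IntegrableOn (fun x : ℝ => Delta510 L₂ t₀ x * ((x : ℂ) ^ (s - 1) - 1))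
      (Ioo (t₀ - ℓ) (t₀ + ℓ)) :=
    (hfW.sub hΔW).congr (Eventually.of_forall fun x => by simp only [Pi.sub_apply]; ring)
  -- term 1: the far part
  have hT1 : ‖∫ x in Ioi 0 \ Ioo (t₀ - ℓ) (t₀ + ℓ), Delta510 L₂ t₀ x * (x : ℂ) ^ (s - 1)‖
      ≤ ∫ x in Ioi 0 \ Ioo (t₀ - ℓ) (t₀ + ℓ), ‖Delta510 L₂ t₀ x‖ * x ^ (s.re - 1) := by
    calc ‖∫ x in Ioi 0 \ Ioo (t₀ - ℓ) (t₀ + ℓ), Delta510 L₂ t₀ x * (x : ℂ) ^ (s - 1)‖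
        ≤ ∫ x in Ioi 0 \ Ioo (t₀ - ℓ) (t₀ + ℓ), ‖Delta510 L₂ t₀ x * (x : ℂ) ^ (s - 1)‖ :=
          norm_integral_le_integral_norm _
      _ = ∫ x in Ioi 0 \ Ioo (t₀ - ℓ) (t₀ + ℓ), ‖Delta510 L₂ t₀ x‖ * x ^ (s.re - 1) := by
          refine setIntegral_congr_fun (measurableSet_Ioi.diff measurableSet_Ioo) fun x hx => ?_
          have hx0 : (0 : ℝ) < x := hx.1
          rw [norm_mul, Complex.norm_cpow_eq_rpow_re_of_pos hx0, sub_re, one_re]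
  -- term 2: the window factor `x^{s−1} − 1`
  have hT2 : ‖∫ x in Ioo (t₀ - ℓ) (t₀ + ℓ), Delta510 L₂ t₀ x * ((x : ℂ) ^ (s - 1) - 1)‖
      ≤ 2 * ‖s - 1‖ * Λ * ∫ x in Ioo (t₀ - ℓ) (t₀ + ℓ), ‖Delta510 L₂ t₀ x‖ := by
    calc ‖∫ x in Ioo (t₀ - ℓ) (t₀ + ℓ), Delta510 L₂ t₀ x * ((x : ℂ) ^ (s - 1) - 1)‖
        ≤ ∫ x in Ioo (t₀ - ℓ) (t₀ + ℓ), ‖Delta510 L₂ t₀ x * ((x : ℂ) ^ (s - 1) - 1)‖ :=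
          norm_integral_le_integral_norm _
      _ ≤ ∫ x in Ioo (t₀ - ℓ) (t₀ + ℓ), 2 * ‖s - 1‖ * Λ * ‖Delta510 L₂ t₀ x‖ := by
          refine setIntegral_mono_on h2.norm (hΔW.norm.const_mul _) measurableSet_Ioo
            fun x hx => ?_
          have hx0 : (0 : ℝ) < x := hW hx
          have h1 : ‖s - 1‖ * |Real.log x| ≤ 1 :=
            (mul_le_mul_of_nonneg_left (hΛ x hx) (norm_nonneg _)).trans hsΛ
          have h2 := norm_cpow_sub_one_le hx0 h1
          rw [norm_mul]
          have h3 : ‖(x : ℂ) ^ (s - 1) - 1‖ ≤ 2 * ‖s - 1‖ * Λ := by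
            calc ‖(x : ℂ) ^ (s - 1) - 1‖ ≤ 2 * (‖s - 1‖ * |Real.log x|) := h2
              _ ≤ 2 * (‖s - 1‖ * Λ) := by gcongr; exact hΛ x hx
              _ = 2 * ‖s - 1‖ * Λ := by ring
          calc ‖Delta510 L₂ t₀ x‖ * ‖(x : ℂ) ^ (s - 1) - 1‖
              ≤ ‖Delta510 L₂ t₀ x‖ * (2 * ‖s - 1‖ * Λ) :=
                mul_le_mul_of_nonneg_left h3 (norm_nonneg _)
            _ = 2 * ‖s - 1‖ * Λ * ‖Delta510 L₂ t₀ x‖ := by ring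
      _ = 2 * ‖s - 1‖ * Λ * ∫ x in Ioo (t₀ - ℓ) (t₀ + ℓ), ‖Delta510 L₂ t₀ x‖ :=
          MeasureTheory.integral_const_mul _ _
  -- term 3: the window comparison `Δ − ω`
  have hT3 : ‖∫ x in Ioo (t₀ - ℓ) (t₀ + ℓ), (Delta510 L₂ t₀ x - (omegaLine L₂ t₀ x : ℂ))‖
      ≤ ∫ x in Ioo (t₀ - ℓ) (t₀ + ℓ), ‖Delta510 L₂ t₀ x - (omegaLine L₂ t₀ x : ℂ)‖ :=
    norm_integral_le_integral_norm _
  -- term 4: `∫_W ω − 1`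
  have hT4 : ‖(∫ x in Ioo (t₀ - ℓ) (t₀ + ℓ), (omegaLine L₂ t₀ x : ℂ)) - 1‖
      ≤ Real.exp (-(π * ℓ / L₂) ^ 2) := by
    rw [integral_complex_ofReal, ← Complex.ofReal_one, ← Complex.ofReal_sub, Complex.norm_real,
      Real.norm_eq_abs]
    exact abs_integral_omegaLine_window_sub_one_le hL0 t₀ hℓ
  rw [delta514_sub_one_eq hL hℓt hs]
  calc _ ≤ ‖(∫ x in Ioi 0 \ Ioo (t₀ - ℓ) (t₀ + ℓ), Delta510 L₂ t₀ x * (x : ℂ) ^ (s - 1))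
          + (∫ x in Ioo (t₀ - ℓ) (t₀ + ℓ), Delta510 L₂ t₀ x * ((x : ℂ) ^ (s - 1) - 1))
          + (∫ x in Ioo (t₀ - ℓ) (t₀ + ℓ), (Delta510 L₂ t₀ x - (omegaLine L₂ t₀ x : ℂ)))‖
        + ‖(∫ x in Ioo (t₀ - ℓ) (t₀ + ℓ), (omegaLine L₂ t₀ x : ℂ)) - 1‖ := norm_add_le _ _
    _ ≤ ‖∫ x in Ioi 0 \ Ioo (t₀ - ℓ) (t₀ + ℓ), Delta510 L₂ t₀ x * (x : ℂ) ^ (s - 1)‖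
          + ‖∫ x in Ioo (t₀ - ℓ) (t₀ + ℓ), Delta510 L₂ t₀ x * ((x : ℂ) ^ (s - 1) - 1)‖
          + ‖∫ x in Ioo (t₀ - ℓ) (t₀ + ℓ), (Delta510 L₂ t₀ x - (omegaLine L₂ t₀ x : ℂ))‖
        + ‖(∫ x in Ioo (t₀ - ℓ) (t₀ + ℓ), (omegaLine L₂ t₀ x : ℂ)) - 1‖ := by
        gcongr
        exact (norm_add_le _ _).trans (add_le_add (norm_add_le _ _) le_rfl)
    _ ≤ _ := add_le_add (add_le_add (add_le_add hT1 hT2) hT3) hT4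

/-! ## The window terms made explicit by (5.8) -/

/-- `ω(1/2 + 2πix)` is continuous in `x`. [folklore] -/
private lemma continuous_omegaLine (L₂ t₀ : ℝ) : Continuous (omegaLine L₂ t₀) := by
  have e : omegaLine L₂ t₀
      = fun x => Real.sqrt π / L₂ * Real.exp (-(π * (x - t₀) / L₂) ^ 2) := by
    funext x; exact omegaLine_def L₂ t₀ x
  rw [e]
  fun_prop

/-- **The window comparison term of Lemma 5.4 (ii), EXPLICIT by (5.8)**: for `L₂ > 0`,
`0 < ℓ < t₀`, `U ≥ 0`, `√(U² + (πℓ/L₂²)²) ≤ ρ ≤ 1` and `4π(t₀+ℓ)ρ² ≤ 1` (so that (5.8)'s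
hypotheses hold at every `x ∈ W = (t₀−ℓ, t₀+ℓ)`, where `|V| = π|t₀−x|/L₂² ≤ πℓ/L₂²`),
`∫_W ‖Δ(x) − ω(1/2+2πix)‖ dx
  ≤ 2ℓ·(1 + e^{1/(8L₂²)})(√(2π)/L₂)e^{−L₂²U²/2} + (ρ + 4π(t₀+ℓ)ρ²)·(1 + (4πℓ²/L₂²)e^{−L₂²U²})`
("By Lemma 5.3": (5.8) integrated over the window, `∫_W ω ≤ 1`).
[cite: Zhang2022LandauSiegel, §5 Lemma 5.4 (ii) (proof), Lemma 5.3 (5.8)] -/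
theorem integral_window_norm_Delta510_sub_omegaLine_le {L₂ : ℝ} (hL : 0 < L₂) {t₀ ℓ U ρ : ℝ}
    (hℓ : 0 < ℓ) (hℓt : ℓ < t₀) (hU : 0 ≤ U)
    (hρ : Real.sqrt (U ^ 2 + (π * ℓ / L₂ ^ 2) ^ 2) ≤ ρ) (hρ1 : ρ ≤ 1)
    (hxρ : 4 * π * (t₀ + ℓ) * ρ ^ 2 ≤ 1) :
    ∫ x in Ioo (t₀ - ℓ) (t₀ + ℓ), ‖Delta510 L₂ t₀ x - (omegaLine L₂ t₀ x : ℂ)‖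
      ≤ 2 * ℓ * ((1 + Real.exp (1 / (8 * L₂ ^ 2))) * (Real.sqrt (2 * π) / L₂)
            * Real.exp (-(L₂ ^ 2 * U ^ 2 / 2)))
        + (ρ + 4 * π * (t₀ + ℓ) * ρ ^ 2)
            * (1 + 4 * π * ℓ ^ 2 / L₂ ^ 2 * Real.exp (-(L₂ ^ 2 * U ^ 2))) := by
  set T : ℝ := (1 + Real.exp (1 / (8 * L₂ ^ 2))) * (Real.sqrt (2 * π) / L₂)
    * Real.exp (-(L₂ ^ 2 * U ^ 2 / 2)) with hT
  set B : ℝ := ρ + 4 * π * (t₀ + ℓ) * ρ ^ 2 with hB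
  set E : ℝ := Real.exp (-(L₂ ^ 2 * U ^ 2)) with hE
  have hρ0 : 0 ≤ ρ := le_trans (Real.sqrt_nonneg _) hρ
  have ht0 : 0 < t₀ := by linarith
  have hB0 : 0 ≤ B := by positivity
  have hL2 : 0 < L₂ ^ 2 := by positivity
  -- (5.8) pointwise on the window
  have hpt : ∀ x ∈ Ioo (t₀ - ℓ) (t₀ + ℓ),
      ‖Delta510 L₂ t₀ x - (omegaLine L₂ t₀ x : ℂ)‖
        ≤ T + B * (omegaLine L₂ t₀ x + 2 * (π * ℓ / L₂ ^ 2) * E) := by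
    intro x hx
    have hx0 : 0 < x := by linarith [hx.1]
    have hxt : |t₀ - x| ≤ ℓ := by
      rw [abs_le]; constructor <;> linarith [hx.1, hx.2]
    have hVle : |π * (t₀ - x) / L₂ ^ 2| ≤ π * ℓ / L₂ ^ 2 := by
      rw [abs_div, abs_mul, abs_of_pos Real.pi_pos, abs_of_pos hL2]
      gcongr
    have hV2 : (π * (t₀ - x) / L₂ ^ 2) ^ 2 ≤ (π * ℓ / L₂ ^ 2) ^ 2 := by
      rw [← sq_abs (π * (t₀ - x) / L₂ ^ 2)]
      exact pow_le_pow_left₀ (abs_nonneg _) hVle 2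
    have hρx : Real.sqrt (U ^ 2 + (π * (t₀ - x) / L₂ ^ 2) ^ 2) ≤ ρ :=
      le_trans (Real.sqrt_le_sqrt (by linarith)) hρ
    have hxρ' : 4 * π * |x| * ρ ^ 2 ≤ 1 := by
      rw [abs_of_pos hx0]
      calc 4 * π * x * ρ ^ 2 ≤ 4 * π * (t₀ + ℓ) * ρ ^ 2 := by gcongr; exact hx.2.le
        _ ≤ 1 := hxρ
    have h58 := norm_Delta510_sub_omega_le hL t₀ x hU hρx hρ1 hxρ'
    rw [omega_half_eq hL.ne'] at h58
    have htail := tail_le hL hU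
    have hBx : ρ + 4 * π * |x| * ρ ^ 2 ≤ B := by
      rw [hB, abs_of_pos hx0]; gcongr; exact hx.2.le
    have hω0 := omegaLine_nonneg hL t₀ x
    have hin : omegaLine L₂ t₀ x + 2 * |π * (t₀ - x) / L₂ ^ 2| * Real.exp (-(L₂ ^ 2 * U ^ 2))
        ≤ omegaLine L₂ t₀ x + 2 * (π * ℓ / L₂ ^ 2) * E := by rw [hE]; gcongr
    have hin0 : 0 ≤ omegaLine L₂ t₀ x
        + 2 * |π * (t₀ - x) / L₂ ^ 2| * Real.exp (-(L₂ ^ 2 * U ^ 2)) := by positivity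
    calc ‖Delta510 L₂ t₀ x - (omegaLine L₂ t₀ x : ℂ)‖ ≤ _ := h58
      _ ≤ T + B * (omegaLine L₂ t₀ x + 2 * (π * ℓ / L₂ ^ 2) * E) :=
          add_le_add htail (mul_le_mul hBx hin hin0 hB0)
  -- integrate over the window
  have hΔW := integrableOn_Delta510_window hL.ne' t₀ (t₀ - ℓ) (t₀ + ℓ)
  have hωW : IntegrableOn (fun x : ℝ => (omegaLine L₂ t₀ x : ℂ)) (Ioo (t₀ - ℓ) (t₀ + ℓ)) :=
    (integrable_omegaLine hL t₀).ofReal.integrableOn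
  have hlhs : IntegrableOn (fun x : ℝ => ‖Delta510 L₂ t₀ x - (omegaLine L₂ t₀ x : ℂ)‖)
      (Ioo (t₀ - ℓ) (t₀ + ℓ)) := (hΔW.sub hωW).norm
  have hrhs : IntegrableOn (fun x : ℝ => T + B * (omegaLine L₂ t₀ x + 2 * (π * ℓ / L₂ ^ 2) * E))
      (Ioo (t₀ - ℓ) (t₀ + ℓ)) := by
    have hc : Continuous fun x : ℝ => T + B * (omegaLine L₂ t₀ x + 2 * (π * ℓ / L₂ ^ 2) * E) :=
      continuous_const.add (continuous_const.mul ((continuous_omegaLine L₂ t₀).add continuous_const))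
    exact (hc.integrableOn_Icc (a := t₀ - ℓ) (b := t₀ + ℓ)).mono_set Ioo_subset_Icc_self
  have hωint : IntegrableOn (omegaLine L₂ t₀) (Ioo (t₀ - ℓ) (t₀ + ℓ)) :=
    (integrable_omegaLine hL t₀).integrableOn
  have hvol : (volume : Measure ℝ).real (Ioo (t₀ - ℓ) (t₀ + ℓ)) = 2 * ℓ := by
    rw [Real.volume_real_Ioo, max_eq_left (by linarith)]; ring
  have hω1 := (integral_omegaLine_window hL t₀ hℓ).2
  calc ∫ x in Ioo (t₀ - ℓ) (t₀ + ℓ), ‖Delta510 L₂ t₀ x - (omegaLine L₂ t₀ x : ℂ)‖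
      ≤ ∫ x in Ioo (t₀ - ℓ) (t₀ + ℓ), (T + B * (omegaLine L₂ t₀ x + 2 * (π * ℓ / L₂ ^ 2) * E)) :=
        setIntegral_mono_on hlhs hrhs measurableSet_Ioo hpt
    _ = 2 * ℓ * T + B * ((∫ x in Ioo (t₀ - ℓ) (t₀ + ℓ), omegaLine L₂ t₀ x)
          + 2 * ℓ * (2 * (π * ℓ / L₂ ^ 2) * E)) := by
        have hTint : IntegrableOn (fun _ : ℝ => T) (Ioo (t₀ - ℓ) (t₀ + ℓ)) :=
          integrableOn_const (measure_Ioo_lt_top).ne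
        have hCint : IntegrableOn (fun _ : ℝ => 2 * (π * ℓ / L₂ ^ 2) * E) (Ioo (t₀ - ℓ) (t₀ + ℓ)) :=
          integrableOn_const (measure_Ioo_lt_top).ne
        have hinner : IntegrableOn (fun x : ℝ => omegaLine L₂ t₀ x + 2 * (π * ℓ / L₂ ^ 2) * E)
            (Ioo (t₀ - ℓ) (t₀ + ℓ)) := hωint.add hCint
        have hBinner : IntegrableOn
            (fun x : ℝ => B * (omegaLine L₂ t₀ x + 2 * (π * ℓ / L₂ ^ 2) * E))
            (Ioo (t₀ - ℓ) (t₀ + ℓ)) := hinner.const_mul B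
        rw [integral_add hTint hBinner, setIntegral_const, MeasureTheory.integral_const_mul,
          integral_add hωint hCint, setIntegral_const, hvol, smul_eq_mul, smul_eq_mul]
    _ ≤ 2 * ℓ * T + B * (1 + 2 * ℓ * (2 * (π * ℓ / L₂ ^ 2) * E)) := by gcongr
    _ = 2 * ℓ * T + B * (1 + 4 * π * ℓ ^ 2 / L₂ ^ 2 * E) := by
        congr 1; congr 1; congr 1
        field_simp
        ring

/-- **Lemma 5.4 (ii) with the window terms explicit**: under the hypotheses of
`norm_delta514_sub_one_le` and of `integral_window_norm_Delta510_sub_omegaLine_le`, writing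
`M_W = 2ℓ·(1 + e^{1/(8L₂²)})(√(2π)/L₂)e^{−L₂²U²/2} + (ρ + 4π(t₀+ℓ)ρ²)(1 + (4πℓ²/L₂²)e^{−L₂²U²})`,
`‖δ(s) − 1‖ ≤ ∫_{(0,∞)∖W} ‖Δ‖x^{σ−1} + 2‖s−1‖Λ·(M_W + 1) + M_W + e^{−(πℓ/L₂)²}`
(only the far part — "contributes `O(ε)`" by Lemma 5.3 — is left as an integral).
[cite: Zhang2022LandauSiegel, §5 Lemma 5.4 (ii)] -/
theorem norm_delta514_sub_one_le_explicit {L₂ : ℝ} (hL : 1 ≤ L₂) {t₀ ℓ : ℝ} (hℓ : 0 < ℓ)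
    (hℓt : ℓ < t₀) {s : ℂ} (hs : 0 < s.re) {Λ : ℝ}
    (hΛ : ∀ x ∈ Ioo (t₀ - ℓ) (t₀ + ℓ), |Real.log x| ≤ Λ) (hsΛ : ‖s - 1‖ * Λ ≤ 1)
    {U ρ : ℝ} (hU : 0 ≤ U) (hρ : Real.sqrt (U ^ 2 + (π * ℓ / L₂ ^ 2) ^ 2) ≤ ρ) (hρ1 : ρ ≤ 1)
    (hxρ : 4 * π * (t₀ + ℓ) * ρ ^ 2 ≤ 1) :
    ‖delta514 L₂ t₀ s - 1‖
      ≤ (∫ x in Ioi 0 \ Ioo (t₀ - ℓ) (t₀ + ℓ), ‖Delta510 L₂ t₀ x‖ * x ^ (s.re - 1))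
        + 2 * ‖s - 1‖ * Λ * ((2 * ℓ * ((1 + Real.exp (1 / (8 * L₂ ^ 2))) * (Real.sqrt (2 * π) / L₂)
                * Real.exp (-(L₂ ^ 2 * U ^ 2 / 2)))
              + (ρ + 4 * π * (t₀ + ℓ) * ρ ^ 2)
                * (1 + 4 * π * ℓ ^ 2 / L₂ ^ 2 * Real.exp (-(L₂ ^ 2 * U ^ 2)))) + 1)
        + (2 * ℓ * ((1 + Real.exp (1 / (8 * L₂ ^ 2))) * (Real.sqrt (2 * π) / L₂)
                * Real.exp (-(L₂ ^ 2 * U ^ 2 / 2)))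
              + (ρ + 4 * π * (t₀ + ℓ) * ρ ^ 2)
                * (1 + 4 * π * ℓ ^ 2 / L₂ ^ 2 * Real.exp (-(L₂ ^ 2 * U ^ 2))))
        + Real.exp (-(π * ℓ / L₂) ^ 2) := by
  have hL0 : 0 < L₂ := by linarith
  have h1 := norm_delta514_sub_one_le hL hℓ hℓt hs hΛ hsΛ
  have h3 := integral_window_norm_Delta510_sub_omegaLine_le hL0 hℓ hℓt hU hρ hρ1 hxρ
  -- `∫_W ‖Δ‖ ≤ ∫_W ‖Δ − ω‖ + ∫_W ω ≤ M_W + 1`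
  have hΔW := integrableOn_Delta510_window hL0.ne' t₀ (t₀ - ℓ) (t₀ + ℓ)
  have hωW : IntegrableOn (fun x : ℝ => (omegaLine L₂ t₀ x : ℂ)) (Ioo (t₀ - ℓ) (t₀ + ℓ)) :=
    (integrable_omegaLine hL0 t₀).ofReal.integrableOn
  have hωint : IntegrableOn (omegaLine L₂ t₀) (Ioo (t₀ - ℓ) (t₀ + ℓ)) :=
    (integrable_omegaLine hL0 t₀).integrableOn
  have h2 : ∫ x in Ioo (t₀ - ℓ) (t₀ + ℓ), ‖Delta510 L₂ t₀ x‖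
      ≤ (∫ x in Ioo (t₀ - ℓ) (t₀ + ℓ), ‖Delta510 L₂ t₀ x - (omegaLine L₂ t₀ x : ℂ)‖) + 1 := by
    have hω1 := (integral_omegaLine_window hL0 t₀ hℓ).2
    calc ∫ x in Ioo (t₀ - ℓ) (t₀ + ℓ), ‖Delta510 L₂ t₀ x‖
        ≤ ∫ x in Ioo (t₀ - ℓ) (t₀ + ℓ),
            (‖Delta510 L₂ t₀ x - (omegaLine L₂ t₀ x : ℂ)‖ + omegaLine L₂ t₀ x) := by
          refine setIntegral_mono_on hΔW.norm ((hΔW.sub hωW).norm.add hωint) measurableSet_Ioo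
            fun x _ => ?_
          have hω0 := omegaLine_nonneg hL0 t₀ x
          calc ‖Delta510 L₂ t₀ x‖
              = ‖(Delta510 L₂ t₀ x - (omegaLine L₂ t₀ x : ℂ)) + (omegaLine L₂ t₀ x : ℂ)‖ := by
                rw [sub_add_cancel]
            _ ≤ ‖Delta510 L₂ t₀ x - (omegaLine L₂ t₀ x : ℂ)‖ + ‖(omegaLine L₂ t₀ x : ℂ)‖ :=
                norm_add_le _ _
            _ = ‖Delta510 L₂ t₀ x - (omegaLine L₂ t₀ x : ℂ)‖ + omegaLine L₂ t₀ x := by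
                rw [Complex.norm_real, Real.norm_of_nonneg hω0]
      _ = (∫ x in Ioo (t₀ - ℓ) (t₀ + ℓ), ‖Delta510 L₂ t₀ x - (omegaLine L₂ t₀ x : ℂ)‖)
          + ∫ x in Ioo (t₀ - ℓ) (t₀ + ℓ), omegaLine L₂ t₀ x :=
          integral_add (hΔW.sub hωW).norm hωint
      _ ≤ _ := by gcongr
  have hc0 : 0 ≤ 2 * ‖s - 1‖ * Λ := by
    rcases le_or_gt 0 Λ with hΛ0 | hΛ0
    · positivity
    · -- `Λ < 0` is impossible on a nonempty window: `|log t₀| ≤ Λ`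
      have ht : t₀ ∈ Ioo (t₀ - ℓ) (t₀ + ℓ) := ⟨by linarith, by linarith⟩
      have := hΛ t₀ ht
      linarith [abs_nonneg (Real.log t₀)]
  calc ‖delta514 L₂ t₀ s - 1‖ ≤ _ := h1
    _ ≤ _ := by gcongr; exact h2.trans (by linarith)

end Lemma53

end Literature.NumberTheory.LFunctions.Zhang2022
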